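import Summits.ValiantsHypothesis.ValiantsHypothesis.Theorems.KPlusLogSqLawTropicalGradedWalkDomDGlue1

/-!
# Dominance glue (type D), part 4: wrap columns

GRW-lite `K = 4` graded-walk family (census side of the tropical root law, all `m`):
dominance glue for the diagonal states `(w, u, 0)`, `u < w < m`, of the design typed in
`KPlusLogSqLawTropicalGradedWalkDefs`.  The slack of every rival cell against the column
potential `UD` (file `…PotD`) was certified family by family in `…DomD1` – `…DomD13`; the files
`…DomDGlue1` – `…DomDGlue5` dispatch an arbitrary rival `(a, b, l)` to its family and conclude
`IsDominant` for these states via `isDominant_of_scaledPotential`.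

Honest framing: this is a census-side (lower-bound) construction — a quadratic family of
distinct optimal slopes for `TropRootLawAt (n+1) 4`.  It says nothing about `TropicalB` inside
its window and nothing about VP ≠ VNP.
-/

set_option linter.dupNamespace false
set_option autoImplicit false

namespace Summit.ValiantsHypothesis.ValiantsHypothesis.Theorems.LacunarySymmetroidMatrixDescartes.TropicalCensus

namespace GradedWalk

open Summit.ValiantsHypothesis.ValiantsHypothesis.Theorems.MatrixDescartes.Negative

variable (n : ℕ)

/-! ### slack, wrap column -/

/-- slack of the type-D certificate: wrap column `b ≥ w` (intended cell `(b - w, b, 0)`). -/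
theorem slackD_wrapcol (w u : ℕ) (huw : u < w) (hwn : w ≤ n) (a b : Fin (n + 1)) (l : Fin 4)
    (hp : ee n a b l ≠ 0) (hne : rot n w b ≠ a ∨ lam n w u 0 b ≠ l) (hwb : w ≤ (b : ℕ)) :
    1 * (thD n w u * (dd n l : ℤ) - vv n a b l) <
      UD n w u a + ((thD n w u * (dd n (lam n w u 0 b) : ℤ) - vv n (rot n w b) b (lam n w u 0 b)) - UD n w u (rot n w b)) := by
  have hw1 : w ≤ n + 1 := by omega
  have hbn : (b : ℕ) ≤ n := by omega
  have han : (a : ℕ) ≤ n := by omega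
  have hr := rot_val_wrap n hw1 b hwb
  have hrb : (((rot n w b : Fin (n + 1)) : ℕ)) < (b : ℕ) := by rw [hr]; omega
  rw [lam_D n huw, if_pos hwb] at hne ⊢
  have hcw : ((((rot n w b : Fin (n + 1)) : ℕ) : ℤ)) = ((b : ℕ) : ℤ) - ((w : ℕ) : ℤ) := by
    rw [hr]; push_cast [Nat.cast_sub hwb]; ring
  have hT0 : thD n w u * (dd n 0 : ℤ) - vv n (rot n w b) b 0 = ((0 : ℤ) - 4 * mZ n * gG n ^ 2 * ((w : ℕ) : ℤ) ^ 2) := by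
    rw [dd_cast_zero, vv_upper_zero n hrb, hcw]; ring
  have hUr : UD n w u ((rot n w b : Fin (n + 1)) : ℕ) = gG n * thD n w u * ((((b : ℕ) - w) : ℕ) : ℤ) := by
    rw [hr]; unfold UD; rw [show (b : ℕ) - w - (n + 1 - w) = 0 by omega, muD_zero, add_zero]
  by_cases hab : (a : ℕ) < (b : ℕ)
  · -- upper cells: classes 0 and 1
    have hl : l = 0 ∨ l = 1 := by
      rcases (show l = 0 ∨ l = 1 ∨ l = 2 ∨ l = 3 by fin_cases l <;> simp) with rfl | rfl | rfl | rfl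
      · exact Or.inl rfl
      · exact Or.inr rfl
      · exact absurd (ee_upper_ge_two n hab 2 (by decide)) hp
      · exact absurd (ee_upper_ge_two n hab 3 (by decide)) hp
    obtain ⟨E0, hE0⟩ : ∃ E0, (a : ℕ) + E0 = (b : ℕ) := ⟨(b : ℕ) - (a : ℕ), by omega⟩
    have haE : (a : ℕ) = (b : ℕ) - E0 := by omega
    rcases Nat.lt_trichotomy (a : ℕ) ((b : ℕ) - w) with har | har | har
    · -- above the intended cell
      have hY : UD n w u a - UD n w u ((rot n w b : Fin (n + 1)) : ℕ) = (gG n * thD n w u * ((((b : ℕ) - E0) : ℕ) : ℤ) - gG n * thD n w u * ((((b : ℕ) - w) : ℕ) : ℤ)) := by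
        rw [hUr]; unfold UD; rw [show (a : ℕ) - (n + 1 - w) = 0 by omega, muD_zero, add_zero, haE]
      rcases hl with rfl | rfl
      · have hc : (((((b : ℕ)) - ((b : ℕ) - E0) : ℕ)) : ℤ) = ((b : ℕ) : ℤ) - ((a : ℕ) : ℤ) := by
          push_cast [Nat.cast_sub (show (b : ℕ) - E0 ≤ (b : ℕ) by omega), Nat.cast_sub (show E0 ≤ (b : ℕ) by omega)]; omega
        have hX : thD n w u * (dd n 0 : ℤ) - vv n a b 0 = ((0 : ℤ) - 4 * mZ n * gG n ^ 2 * (((((b : ℕ)) - ((b : ℕ) - E0)) : ℕ) : ℤ) ^ 2) := by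
          rw [dd_cast_zero, vv_upper_zero n hab, hc]; ring
        exact slack_of (D_wc0_up n w u b E0 (by omega) (by omega) (by omega) hbn) hX hT0 hY
      · have hX : thD n w u * (dd n 1 : ℤ) - vv n a b 1 = (thD n w u * d1 n - conn n (((b : ℕ)) - ((b : ℕ) - E0)) ((b : ℕ))) := by
          rw [dd_cast_one, vv_upper_one n hab, haE]
        exact slack_of (D_wcn_up n w u b E0 (by omega) (by omega) (by omega) hbn) hX hT0 hY
    · -- the intended position: only class 1 is a rival
      rcases hl with rfl | rfl
      · rcases hne with h | h
        · exact absurd (Fin.ext (by omega)) h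
        · exact absurd rfl h
      · have hX : thD n w u * (dd n 1 : ℤ) - vv n a b 1 = (thD n w u * d1 n - conn n (((b : ℕ)) - ((b : ℕ) - w)) ((b : ℕ))) := by
          rw [dd_cast_one, vv_upper_one n hab, har]
        have hY : UD n w u a - UD n w u ((rot n w b : Fin (n + 1)) : ℕ) = (0 : ℤ) := by
          rw [show (a : ℕ) = ((rot n w b : Fin (n + 1)) : ℕ) by omega, sub_self]
        exact slack_of (D_wcn_at n w u b (by omega) hwb hbn) hX hT0 hY
    · -- between the intended cell and the diagonal
      rcases Nat.lt_or_ge (n + 1 - w) (a : ℕ) with hblk | hpl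
      · obtain ⟨jp, hjp⟩ : ∃ jp, (a : ℕ) = (n + 1 - w) + jp := ⟨(a : ℕ) - (n + 1 - w), by omega⟩
        by_cases hu0 : u = 0
        · subst hu0
          have hbj : (b : ℕ) = (n + 1 - w) + jp + E0 := by omega
          have hY : UD n w 0 a - UD n w 0 ((rot n w b : Fin (n + 1)) : ℕ) = ((gG n * thD n w 0 * ((((n + 1 - w) + jp) : ℕ) : ℤ) + SLB0 n w jp) - gG n * thD n w 0 * ((((n + 1 - w) + jp + E0 - w) : ℕ) : ℤ)) := by
            rw [hUr]; unfold UD; rw [show (a : ℕ) - (n + 1 - w) = jp by omega, muD_z, hjp, hbj]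
          rcases hl with rfl | rfl
          · have hc : (((((n + 1 - w) + jp + E0) - ((n + 1 - w) + jp) : ℕ)) : ℤ) = ((b : ℕ) : ℤ) - ((a : ℕ) : ℤ) := by
              push_cast [Nat.cast_sub (show (n + 1 - w) + jp ≤ (n + 1 - w) + jp + E0 by omega), Nat.cast_sub hw1]; omega
            have hX : thD n w 0 * (dd n 0 : ℤ) - vv n a b 0 = ((0 : ℤ) - 4 * mZ n * gG n ^ 2 * (((((n + 1 - w) + jp + E0) - ((n + 1 - w) + jp)) : ℕ) : ℤ) ^ 2) := by
              rw [dd_cast_zero, vv_upper_zero n hab, hc]; ring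
            exact slack_of (D_wc0_dnB_z n w jp E0 (n + 1 - w) (by omega) (by omega) (by omega) (by omega)) hX hT0 hY
          · have hX : thD n w 0 * (dd n 1 : ℤ) - vv n a b 1 = (thD n w 0 * d1 n - conn n (((n + 1 - w) + jp + E0) - ((n + 1 - w) + jp)) ((n + 1 - w) + jp + E0)) := by
              rw [dd_cast_one, vv_upper_one n hab, hjp, hbj]
            exact slack_of (D_wcn_dnB_z n w jp E0 (n + 1 - w) (by omega) (by omega) (by omega) (by omega)) hX hT0 hY
        · rcases Nat.lt_trichotomy jp u with hju | hju | hju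
          · rcases Nat.lt_or_ge (E0 + jp) u with hEu | hEu
            · have hbj : (b : ℕ) = (n + 1 - w) + jp + E0 := by omega
              have hY : UD n w u a - UD n w u ((rot n w b : Fin (n + 1)) : ℕ) = ((gG n * thD n w u * ((((n + 1 - w) + jp) : ℕ) : ℤ) + SUB2 n w u jp) - gG n * thD n w u * ((((n + 1 - w) + jp + E0 - w) : ℕ) : ℤ)) := by
                rw [hUr]; unfold UD; rw [show (a : ℕ) - (n + 1 - w) = jp by omega, muD_lt n hju, hjp, hbj]
              rcases hl with rfl | rfl
              · have hc : (((((n + 1 - w) + jp + E0) - ((n + 1 - w) + jp) : ℕ)) : ℤ) = ((b : ℕ) : ℤ) - ((a : ℕ) : ℤ) := by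
                  push_cast [Nat.cast_sub (show (n + 1 - w) + jp ≤ (n + 1 - w) + jp + E0 by omega), Nat.cast_sub hw1]; omega
                have hX : thD n w u * (dd n 0 : ℤ) - vv n a b 0 = ((0 : ℤ) - 4 * mZ n * gG n ^ 2 * (((((n + 1 - w) + jp + E0) - ((n + 1 - w) + jp)) : ℕ) : ℤ) ^ 2) := by
                  rw [dd_cast_zero, vv_upper_zero n hab, hc]; ring
                exact slack_of (D_wc0_dnB_le1 n w u jp E0 (n + 1 - w) (by omega) (by omega) (by omega) (by omega) (by omega)) hX hT0 hY
              · have hX : thD n w u * (dd n 1 : ℤ) - vv n a b 1 = (thD n w u * d1 n - conn n (((n + 1 - w) + jp + E0) - ((n + 1 - w) + jp)) ((n + 1 - w) + jp + E0)) := by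
                  rw [dd_cast_one, vv_upper_one n hab, hjp, hbj]
                exact slack_of (D_wcn_dnB_le1 n w u jp E0 (n + 1 - w) (by omega) (by omega) (by omega) (by omega) (by omega)) hX hT0 hY
            · have hbj : (b : ℕ) = (n + 1 - w) + jp + E0 := by omega
              have hY : UD n w u a - UD n w u ((rot n w b : Fin (n + 1)) : ℕ) = ((gG n * thD n w u * ((((n + 1 - w) + jp) : ℕ) : ℤ) + SUB2 n w u jp) - gG n * thD n w u * ((((n + 1 - w) + jp + E0 - w) : ℕ) : ℤ)) := by
                rw [hUr]; unfold UD; rw [show (a : ℕ) - (n + 1 - w) = jp by omega, muD_lt n hju, hjp, hbj]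
              rcases hl with rfl | rfl
              · have hc : (((((n + 1 - w) + jp + E0) - ((n + 1 - w) + jp) : ℕ)) : ℤ) = ((b : ℕ) : ℤ) - ((a : ℕ) : ℤ) := by
                  push_cast [Nat.cast_sub (show (n + 1 - w) + jp ≤ (n + 1 - w) + jp + E0 by omega), Nat.cast_sub hw1]; omega
                have hX : thD n w u * (dd n 0 : ℤ) - vv n a b 0 = ((0 : ℤ) - 4 * mZ n * gG n ^ 2 * (((((n + 1 - w) + jp + E0) - ((n + 1 - w) + jp)) : ℕ) : ℤ) ^ 2) := by
                  rw [dd_cast_zero, vv_upper_zero n hab, hc]; ring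
                exact slack_of (D_wc0_dnB_le2 n w u jp E0 (n + 1 - w) (by omega) (by omega) (by omega) (by omega) (by omega) (by omega)) hX hT0 hY
              · have hX : thD n w u * (dd n 1 : ℤ) - vv n a b 1 = (thD n w u * d1 n - conn n (((n + 1 - w) + jp + E0) - ((n + 1 - w) + jp)) ((n + 1 - w) + jp + E0)) := by
                  rw [dd_cast_one, vv_upper_one n hab, hjp, hbj]
                exact slack_of (D_wcn_dnB_le2 n w u jp E0 (n + 1 - w) (by omega) (by omega) (by omega) (by omega) (by omega) (by omega)) hX hT0 hY
          · rw [hju] at hjp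
            have hbj : (b : ℕ) = (n + 1 - w) + u + E0 := by omega
            have hY : UD n w u a - UD n w u ((rot n w b : Fin (n + 1)) : ℕ) = ((gG n * thD n w u * ((((n + 1 - w) + u) : ℕ) : ℤ) + SUBu n w u) - gG n * thD n w u * ((((n + 1 - w) + u + E0 - w) : ℕ) : ℤ)) := by
              rw [hUr]; unfold UD; rw [show (a : ℕ) - (n + 1 - w) = u by omega, muD_ge n hu0 (lt_irrefl _), SLB_self, hjp, hbj]; simp
            rcases hl with rfl | rfl
            · have hc : (((((n + 1 - w) + u + E0) - ((n + 1 - w) + u) : ℕ)) : ℤ) = ((b : ℕ) : ℤ) - ((a : ℕ) : ℤ) := by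
                push_cast [Nat.cast_sub (show (n + 1 - w) + u ≤ (n + 1 - w) + u + E0 by omega), Nat.cast_sub hw1]; omega
              have hX : thD n w u * (dd n 0 : ℤ) - vv n a b 0 = ((0 : ℤ) - 4 * mZ n * gG n ^ 2 * (((((n + 1 - w) + u + E0) - ((n + 1 - w) + u)) : ℕ) : ℤ) ^ 2) := by
                rw [dd_cast_zero, vv_upper_zero n hab, hc]; ring
              exact slack_of (D_wc0_dnB_u n w u E0 (n + 1 - w) (by omega) (by omega) (by omega) (by omega)) hX hT0 hY
            · have hX : thD n w u * (dd n 1 : ℤ) - vv n a b 1 = (thD n w u * d1 n - conn n (((n + 1 - w) + u + E0) - ((n + 1 - w) + u)) ((n + 1 - w) + u + E0)) := by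
                rw [dd_cast_one, vv_upper_one n hab, hjp, hbj]
              exact slack_of (D_wcn_dnB_u n w u E0 (n + 1 - w) (by omega) (by omega) (by omega) (by omega)) hX hT0 hY
          · have hbj : (b : ℕ) = (n + 1 - w) + jp + E0 := by omega
            have hY : UD n w u a - UD n w u ((rot n w b : Fin (n + 1)) : ℕ) = ((gG n * thD n w u * ((((n + 1 - w) + jp) : ℕ) : ℤ) + (SUBu n w u + SLB n w u jp)) - gG n * thD n w u * ((((n + 1 - w) + jp + E0 - w) : ℕ) : ℤ)) := by
              rw [hUr]; unfold UD; rw [show (a : ℕ) - (n + 1 - w) = jp by omega, muD_ge n hu0 (by omega), hjp, hbj]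
            rcases hl with rfl | rfl
            · have hc : (((((n + 1 - w) + jp + E0) - ((n + 1 - w) + jp) : ℕ)) : ℤ) = ((b : ℕ) : ℤ) - ((a : ℕ) : ℤ) := by
                push_cast [Nat.cast_sub (show (n + 1 - w) + jp ≤ (n + 1 - w) + jp + E0 by omega), Nat.cast_sub hw1]; omega
              have hX : thD n w u * (dd n 0 : ℤ) - vv n a b 0 = ((0 : ℤ) - 4 * mZ n * gG n ^ 2 * (((((n + 1 - w) + jp + E0) - ((n + 1 - w) + jp)) : ℕ) : ℤ) ^ 2) := by
                rw [dd_cast_zero, vv_upper_zero n hab, hc]; ring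
              exact slack_of (D_wc0_dnB_gt n w u jp E0 (n + 1 - w) (by omega) (by omega) (by omega) (by omega) (by omega)) hX hT0 hY
            · have hX : thD n w u * (dd n 1 : ℤ) - vv n a b 1 = (thD n w u * d1 n - conn n (((n + 1 - w) + jp + E0) - ((n + 1 - w) + jp)) ((n + 1 - w) + jp + E0)) := by
                rw [dd_cast_one, vv_upper_one n hab, hjp, hbj]
              exact slack_of (D_wcn_dnB_gt n w u jp E0 (n + 1 - w) (by omega) (by omega) (by omega) (by omega) (by omega)) hX hT0 hY
      · have hY : UD n w u a - UD n w u ((rot n w b : Fin (n + 1)) : ℕ) = (gG n * thD n w u * ((((b : ℕ) - E0) : ℕ) : ℤ) - gG n * thD n w u * ((((b : ℕ) - w) : ℕ) : ℤ)) := by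
          rw [hUr]; unfold UD; rw [show (a : ℕ) - (n + 1 - w) = 0 by omega, muD_zero, add_zero, haE]
        have hc : (((((b : ℕ)) - ((b : ℕ) - E0) : ℕ)) : ℤ) = ((b : ℕ) : ℤ) - ((a : ℕ) : ℤ) := by
          push_cast [Nat.cast_sub (show (b : ℕ) - E0 ≤ (b : ℕ) by omega), Nat.cast_sub (show E0 ≤ (b : ℕ) by omega)]; omega
        rcases Nat.lt_or_ge u E0 with hEu | hEu
        · rcases hl with rfl | rfl
          · have hX : thD n w u * (dd n 0 : ℤ) - vv n a b 0 = ((0 : ℤ) - 4 * mZ n * gG n ^ 2 * (((((b : ℕ)) - ((b : ℕ) - E0)) : ℕ) : ℤ) ^ 2) := by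
              rw [dd_cast_zero, vv_upper_zero n hab, hc]; ring
            exact slack_of (D_wc0_dnP2 n w u b E0 (by omega) (by omega) hwb (by omega)) hX hT0 hY
          · have hX : thD n w u * (dd n 1 : ℤ) - vv n a b 1 = (thD n w u * d1 n - conn n (((b : ℕ)) - ((b : ℕ) - E0)) ((b : ℕ))) := by
              rw [dd_cast_one, vv_upper_one n hab, haE]
            exact slack_of (D_wcn_dnP2 n w u b E0 (by omega) (by omega) hwb (by omega)) hX hT0 hY
        · rcases hl with rfl | rfl
          · have hX : thD n w u * (dd n 0 : ℤ) - vv n a b 0 = ((0 : ℤ) - 4 * mZ n * gG n ^ 2 * (((((b : ℕ)) - ((b : ℕ) - E0)) : ℕ) : ℤ) ^ 2) := by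
              rw [dd_cast_zero, vv_upper_zero n hab, hc]; ring
            exact slack_of (D_wc0_dnP1 n w u b E0 hEu (by omega) hwb (by omega)) hX hT0 hY
          · have hX : thD n w u * (dd n 1 : ℤ) - vv n a b 1 = (thD n w u * d1 n - conn n (((b : ℕ)) - ((b : ℕ) - E0)) ((b : ℕ))) := by
              rw [dd_cast_one, vv_upper_one n hab, haE]
            exact slack_of (D_wcn_dnP1 n w u b E0 hEu (by omega) hwb (by omega)) hX hT0 hY
  · rcases Nat.eq_or_lt_of_le (Nat.le_of_not_lt hab) with hba | hba
    · -- the diagonal cell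
      have hab' : (a : ℕ) = (b : ℕ) := hba.symm
      by_cases hcl : l = 0
      · subst hcl
        rcases Nat.lt_or_ge (n + 1 - w) (a : ℕ) with hblk | hpl
        · obtain ⟨jp, hjp⟩ : ∃ jp, (a : ℕ) = (n + 1 - w) + jp := ⟨(a : ℕ) - (n + 1 - w), by omega⟩
          by_cases hu0 : u = 0
          · subst hu0
            have hbj : (b : ℕ) = (n + 1 - w) + jp + 0 := by omega
            have hY : UD n w 0 a - UD n w 0 ((rot n w b : Fin (n + 1)) : ℕ) = ((gG n * thD n w 0 * ((((n + 1 - w) + jp) : ℕ) : ℤ) + SLB0 n w jp) - gG n * thD n w 0 * ((((n + 1 - w) + jp + 0 - w) : ℕ) : ℤ)) := by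
              rw [hUr]; unfold UD; rw [show (a : ℕ) - (n + 1 - w) = jp by omega, muD_z, hjp, hbj]
            have hX : thD n w 0 * (dd n 0 : ℤ) - vv n a b 0 = ((0 : ℤ) - 4 * mZ n * gG n ^ 2 * (((((n + 1 - w) + jp + 0) - ((n + 1 - w) + jp)) : ℕ) : ℤ) ^ 2) := by
              rw [dd_cast_zero, vv_diag_zero n hab']; simp
            exact slack_of (D_wc0_dnB_z n w jp 0 (n + 1 - w) (by omega) (by omega) (by omega) (by omega)) hX hT0 hY
          · rcases Nat.lt_trichotomy jp u with hju | hju | hju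
            · have hbj : (b : ℕ) = (n + 1 - w) + jp + 0 := by omega
              have hY : UD n w u a - UD n w u ((rot n w b : Fin (n + 1)) : ℕ) = ((gG n * thD n w u * ((((n + 1 - w) + jp) : ℕ) : ℤ) + SUB2 n w u jp) - gG n * thD n w u * ((((n + 1 - w) + jp + 0 - w) : ℕ) : ℤ)) := by
                rw [hUr]; unfold UD; rw [show (a : ℕ) - (n + 1 - w) = jp by omega, muD_lt n hju, hjp, hbj]
              have hX : thD n w u * (dd n 0 : ℤ) - vv n a b 0 = ((0 : ℤ) - 4 * mZ n * gG n ^ 2 * (((((n + 1 - w) + jp + 0) - ((n + 1 - w) + jp)) : ℕ) : ℤ) ^ 2) := by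
                rw [dd_cast_zero, vv_diag_zero n hab']; simp
              exact slack_of (D_wc0_dnB_le1 n w u jp 0 (n + 1 - w) (by omega) (by omega) (by omega) (by omega) (by omega)) hX hT0 hY
            · rw [hju] at hjp
              have hbj : (b : ℕ) = (n + 1 - w) + u + 0 := by omega
              have hY : UD n w u a - UD n w u ((rot n w b : Fin (n + 1)) : ℕ) = ((gG n * thD n w u * ((((n + 1 - w) + u) : ℕ) : ℤ) + SUBu n w u) - gG n * thD n w u * ((((n + 1 - w) + u + 0 - w) : ℕ) : ℤ)) := by
                rw [hUr]; unfold UD; rw [show (a : ℕ) - (n + 1 - w) = u by omega, muD_ge n hu0 (lt_irrefl _), SLB_self, hjp, hbj]; simp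
              have hX : thD n w u * (dd n 0 : ℤ) - vv n a b 0 = ((0 : ℤ) - 4 * mZ n * gG n ^ 2 * (((((n + 1 - w) + u + 0) - ((n + 1 - w) + u)) : ℕ) : ℤ) ^ 2) := by
                rw [dd_cast_zero, vv_diag_zero n hab']; simp
              exact slack_of (D_wc0_dnB_u n w u 0 (n + 1 - w) (by omega) (by omega) (by omega) (by omega)) hX hT0 hY
            · have hbj : (b : ℕ) = (n + 1 - w) + jp + 0 := by omega
              have hY : UD n w u a - UD n w u ((rot n w b : Fin (n + 1)) : ℕ) = ((gG n * thD n w u * ((((n + 1 - w) + jp) : ℕ) : ℤ) + (SUBu n w u + SLB n w u jp)) - gG n * thD n w u * ((((n + 1 - w) + jp + 0 - w) : ℕ) : ℤ)) := by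
                rw [hUr]; unfold UD; rw [show (a : ℕ) - (n + 1 - w) = jp by omega, muD_ge n hu0 (by omega), hjp, hbj]
              have hX : thD n w u * (dd n 0 : ℤ) - vv n a b 0 = ((0 : ℤ) - 4 * mZ n * gG n ^ 2 * (((((n + 1 - w) + jp + 0) - ((n + 1 - w) + jp)) : ℕ) : ℤ) ^ 2) := by
                rw [dd_cast_zero, vv_diag_zero n hab']; simp
              exact slack_of (D_wc0_dnB_gt n w u jp 0 (n + 1 - w) (by omega) (by omega) (by omega) (by omega) (by omega)) hX hT0 hY
        · have hY : UD n w u a - UD n w u ((rot n w b : Fin (n + 1)) : ℕ) = (gG n * thD n w u * ((((b : ℕ) - 0) : ℕ) : ℤ) - gG n * thD n w u * ((((b : ℕ) - w) : ℕ) : ℤ)) := by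
            rw [hUr]; unfold UD; rw [show (a : ℕ) - (n + 1 - w) = 0 by omega, muD_zero, add_zero, show (a : ℕ) = (b : ℕ) - 0 by omega]
          have hX : thD n w u * (dd n 0 : ℤ) - vv n a b 0 = ((0 : ℤ) - 4 * mZ n * gG n ^ 2 * (((((b : ℕ)) - ((b : ℕ) - 0)) : ℕ) : ℤ) ^ 2) := by
            rw [dd_cast_zero, vv_diag_zero n hab']; simp
          exact slack_of (D_wc0_dnP1 n w u b 0 (by omega) (by omega) hwb (by omega)) hX hT0 hY
      · have hX1 : thD n w u * (dd n 1 : ℤ) - vv n a b 1 = thD n w u * d1 n - v1 n (n + 1) b := by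
          rw [dd_cast_one, vv_diag n hab' 1 (by decide), vblk_one]
        have hXl : thD n w u * (dd n l : ℤ) - vv n a b l + 1 ≤ thD n w u * d1 n - v1 n (n + 1) b + 1 ∨ l = 1 := by
          rcases (show l = 0 ∨ l = 1 ∨ l = 2 ∨ l = 3 by fin_cases l <;> simp) with rfl | rfl | rfl | rfl
          · exact absurd rfl hcl
          · exact Or.inr rfl
          · left; rw [dd_cast_two, vv_diag n hab' 2 (by decide), vblk_two]
            linarith [D_fut2_m n w u b (by omega) hwn]
          · left; rw [dd_cast_three, vv_diag n hab' 3 (by decide), vblk_three]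
            linarith [D_fut3_m n w u b (by omega) hwn]
        have hXl : thD n w u * (dd n l : ℤ) - vv n a b l ≤ thD n w u * d1 n - v1 n (n + 1) b := by
          rcases hXl with h | rfl
          · linarith
          · exact le_of_eq hX1
        clear hX1
        rcases Nat.lt_or_ge (n + 1 - w) (a : ℕ) with hblk | hpl
        · obtain ⟨jp, hjp⟩ : ∃ jp, (a : ℕ) = (n + 1 - w) + jp := ⟨(a : ℕ) - (n + 1 - w), by omega⟩
          by_cases hu0 : u = 0
          · subst hu0
            have hY : UD n w 0 a - UD n w 0 ((rot n w b : Fin (n + 1)) : ℕ) = ((gG n * thD n w 0 * (((n + 1 - w + jp) : ℕ) : ℤ) + SLB0 n w jp) - gG n * thD n w 0 * ((((b : ℕ) - w) : ℕ) : ℤ)) := by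
              rw [hUr]; unfold UD; rw [show (a : ℕ) - (n + 1 - w) = jp by omega, muD_z, hjp]
            exact slack_le (D_wblk_B_z_m n w b jp (by omega) (by omega) (by omega) (by omega)) hXl hT0 hY
          · rcases Nat.lt_trichotomy jp u with hju | hju | hju
            · have hY : UD n w u a - UD n w u ((rot n w b : Fin (n + 1)) : ℕ) = ((gG n * thD n w u * (((n + 1 - w + jp) : ℕ) : ℤ) + SUB2 n w u jp) - gG n * thD n w u * ((((b : ℕ) - w) : ℕ) : ℤ)) := by
                rw [hUr]; unfold UD; rw [show (a : ℕ) - (n + 1 - w) = jp by omega, muD_lt n hju, hjp]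
              exact slack_le (D_wblk_B_le_m n w u b jp (by omega) (by omega) (by omega) (by omega) (by omega)) hXl hT0 hY
            · rw [hju] at hjp
              have hY : UD n w u a - UD n w u ((rot n w b : Fin (n + 1)) : ℕ) = ((gG n * thD n w u * (((n + 1 - w + u) : ℕ) : ℤ) + SUBu n w u) - gG n * thD n w u * ((((b : ℕ) - w) : ℕ) : ℤ)) := by
                rw [hUr]; unfold UD; rw [show (a : ℕ) - (n + 1 - w) = u by omega, muD_ge n hu0 (lt_irrefl _), SLB_self, hjp]; simp
              exact slack_le (D_wblk_B_u_m n w u b (by omega) (by omega) (by omega) (by omega)) hXl hT0 hY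
            · have hY : UD n w u a - UD n w u ((rot n w b : Fin (n + 1)) : ℕ) = ((gG n * thD n w u * (((n + 1 - w + jp) : ℕ) : ℤ) + (SUBu n w u + SLB n w u jp)) - gG n * thD n w u * ((((b : ℕ) - w) : ℕ) : ℤ)) := by
                rw [hUr]; unfold UD; rw [show (a : ℕ) - (n + 1 - w) = jp by omega, muD_ge n hu0 (by omega), hjp]
              exact slack_le (D_wblk_B_gt_m n w u b jp (by omega) (by omega) (by omega) (by omega) (by omega)) hXl hT0 hY
        · have hY : UD n w u a - UD n w u ((rot n w b : Fin (n + 1)) : ℕ) = (gG n * thD n w u * (((b : ℕ) : ℕ) : ℤ) - gG n * thD n w u * ((((b : ℕ) - w) : ℕ) : ℤ)) := by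
            rw [hUr]; unfold UD; rw [show (a : ℕ) - (n + 1 - w) = 0 by omega, muD_zero, add_zero, hab']
          exact slack_le (D_wblk_P_m n w u b (by omega) hwb (by omega)) hXl hT0 hY
    · -- below the diagonal
      have hba' : (b : ℕ) < (a : ℕ) := hba
      have hcl : l ≠ 0 := fun h0 => by subst h0; exact hp (ee_lower_zero n hba')
      obtain ⟨E, hEa⟩ : ∃ E, n + 1 + (b : ℕ) - (a : ℕ) = E := ⟨_, rfl⟩
      have hne1 : E ≠ n + 1 := by omega
      have hX1 : thD n w u * (dd n 1 : ℤ) - vv n a b 1 = thD n w u * d1 n - v1 n E b := by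
        rw [dd_cast_one, vv_lower n hba', hEa, vblk_one]
      have hXl : thD n w u * (dd n l : ℤ) - vv n a b l + 1 ≤ thD n w u * d1 n - v1 n E b + 1 ∨ l = 1 := by
        rcases (show l = 0 ∨ l = 1 ∨ l = 2 ∨ l = 3 by fin_cases l <;> simp) with rfl | rfl | rfl | rfl
        · exact absurd rfl hcl
        · exact Or.inr rfl
        · left; rw [dd_cast_two, vv_lower n hba', hEa, vblk_two, tau2_of_ne n hne1]
          linarith [D_fut2_lt1 n w u b E (by omega) (by omega) (by omega)]
        · left; rw [dd_cast_three, vv_lower n hba', hEa, vblk_three, tau2_of_ne n hne1, tau3_of_ne n hne1]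
          linarith [D_fut3_lt1 n w u b E (by omega) (by omega) (by omega)]
      have hXl : thD n w u * (dd n l : ℤ) - vv n a b l ≤ thD n w u * d1 n - v1 n E b := by
        rcases hXl with h | rfl
        · linarith
        · exact le_of_eq hX1
      clear hX1
      rcases Nat.lt_or_ge (n + 1 - w) (a : ℕ) with hblk | hpl
      · obtain ⟨jp, hjp⟩ : ∃ jp, (a : ℕ) = (n + 1 - w) + jp := ⟨(a : ℕ) - (n + 1 - w), by omega⟩
        by_cases hu0 : u = 0
        · subst hu0
          have hY : UD n w 0 a - UD n w 0 ((rot n w b : Fin (n + 1)) : ℕ) = ((gG n * thD n w 0 * (((n + 1 - w + jp) : ℕ) : ℤ) + SLB0 n w jp) - gG n * thD n w 0 * ((((b : ℕ) - w) : ℕ) : ℤ)) := by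
            rw [hUr]; unfold UD; rw [show (a : ℕ) - (n + 1 - w) = jp by omega, muD_z, hjp]
          rw [show E = w + (b : ℕ) - jp by omega] at hXl
          exact slack_le (D_wblk_B_z_lt n w b jp (by omega) (by omega) (by omega) (by omega)) hXl hT0 hY
        · rcases Nat.lt_trichotomy jp u with hju | hju | hju
          · have hY : UD n w u a - UD n w u ((rot n w b : Fin (n + 1)) : ℕ) = ((gG n * thD n w u * (((n + 1 - w + jp) : ℕ) : ℤ) + SUB2 n w u jp) - gG n * thD n w u * ((((b : ℕ) - w) : ℕ) : ℤ)) := by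
              rw [hUr]; unfold UD; rw [show (a : ℕ) - (n + 1 - w) = jp by omega, muD_lt n hju, hjp]
            rw [show E = w + (b : ℕ) - jp by omega] at hXl
            exact slack_le (D_wblk_B_le_lt n w u b jp (by omega) (by omega) (by omega) (by omega) (by omega)) hXl hT0 hY
          · rw [hju] at hjp
            have hY : UD n w u a - UD n w u ((rot n w b : Fin (n + 1)) : ℕ) = ((gG n * thD n w u * (((n + 1 - w + u) : ℕ) : ℤ) + SUBu n w u) - gG n * thD n w u * ((((b : ℕ) - w) : ℕ) : ℤ)) := by
              rw [hUr]; unfold UD; rw [show (a : ℕ) - (n + 1 - w) = u by omega, muD_ge n hu0 (lt_irrefl _), SLB_self, hjp]; simp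
            rw [show E = w + (b : ℕ) - u by omega] at hXl
            exact slack_le (D_wblk_B_u_lt n w u b (by omega) (by omega) (by omega) (by omega)) hXl hT0 hY
          · have hY : UD n w u a - UD n w u ((rot n w b : Fin (n + 1)) : ℕ) = ((gG n * thD n w u * (((n + 1 - w + jp) : ℕ) : ℤ) + (SUBu n w u + SLB n w u jp)) - gG n * thD n w u * ((((b : ℕ) - w) : ℕ) : ℤ)) := by
              rw [hUr]; unfold UD; rw [show (a : ℕ) - (n + 1 - w) = jp by omega, muD_ge n hu0 (by omega), hjp]
            rw [show E = w + (b : ℕ) - jp by omega] at hXl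
            exact slack_le (D_wblk_B_gt_lt n w u b jp (by omega) (by omega) (by omega) (by omega) (by omega)) hXl hT0 hY
      · have hY : UD n w u a - UD n w u ((rot n w b : Fin (n + 1)) : ℕ) = (gG n * thD n w u * (((n + 1 - E + (b : ℕ)) : ℕ) : ℤ) - gG n * thD n w u * ((((b : ℕ) - w) : ℕ) : ℤ)) := by
          rw [hUr]; unfold UD; rw [show (a : ℕ) - (n + 1 - w) = 0 by omega, muD_zero, add_zero, show (a : ℕ) = n + 1 - E + (b : ℕ) by omega]
        exact slack_le (D_wblk_P_lt n w u b E (by omega) hwb (by omega) (by omega)) hXl hT0 hY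

end GradedWalk

end Summit.ValiantsHypothesis.ValiantsHypothesis.Theorems.LacunarySymmetroidMatrixDescartes.TropicalCensus
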